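import Summits.FinalStateConjecture.FinalStateConjecture.Theses.MergerLatticeBudget

/-!
# Birth skeleton for crux `PinnedCapture` (stmt-FinalStateConjecture-17315) of route
`MergerLatticeBudget` — file `Cruxes/PinnedCapture/Lines/birth.lean` (BC3, skeleton-register).

The crux (rank 3, re-typed at rev 18 for the T2 summit) is CAPTURE TOWARDS ONE FIXED TARGET: an MGHD
`𝒟` of an admissible datum with complete `𝓘⁺` in which, for ONE sub-extremal configuration
`(N; Mⱼ, aⱼ)` (`Kerr.IsSubextremal`), `(ε,k)`-near-Kerr leaves with exactly these labels recur beyond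
every `J⁻(K)` for every `(k, ε)` — the route's shared leaf block with the phantom repair C′
(`0 < Mᵢ ∧ |aᵢ| ≤ Mᵢ ∧ 0 < ρᵢ < Rᵢ ∧ 2Mᵢ ≤ Rᵢ`: every certified slab `⊇ (Mᵢ, 2Mᵢ] ∋ r₊` is
macroscopic, so the hole count `N` of a leaf is honest and the `N`-sectors do NOT nest through
phantom labels, contrast `Theorems/BartnikGapSettlingCaptureEquivPinned`) — settles exactly as the
Statement demands: a C² `FinalStateDecomposition d` of `O = exteriorOf 𝒟 d.charted` with
sub-extremal holes, `RaysStayInClosure 𝒟 O`, `HasExhaustiveCharts d` (honest radii),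
`IsFutureOriented d`.

It is cut along the two seams the item's own text names ("for N ≤ 1 this is sub-extremal Kerr
stability / Minkowski stability entered at a late hyperboloidal leaf with KNOWN limiting parameters
…; the ray clause is the interior-flavoured part"): the REGIME of the pinned hole count (dispersal
`N = 0` / black holes `N ≥ 1` — independent sectors here, by the phantom repair) for the EXTERIOR
capture, and EXTERIOR versus INTERIOR for the T2 ray clause, the latter split once more into its
dynamical content and a pure causal-theory lemma (the same cut, and for the last stub the SAME
statement, as the sibling skeleton `Cruxes/SettledCapture/Lines/birth.lean` of route
`BartnikGapSettling`, so that one proof of `stub_visibleRaysStay` serves both cruxes):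

* `stub_pinnedDispersal` — PINNED DISPERSAL (sector `N = 0`): maximal, complete `𝓘⁺`, and for every
  `(k, ε, K)` an `(ε,k)`-FLAT hyperboloidal leaf beyond `J⁻(K)` (the block at `N = 0`: one flat chart
  on `U₀ ⊇ {t₀ > −1}`, `ε`-close in `Cᵏ` to `η` on `{t₀ = 0}`, barrier clause) ⇒ `∃ O d` with
  sub-extremal holes, `O = exteriorOf 𝒟 d.charted`, `HasExhaustiveCharts d`, `IsFutureOriented d`
  (expected witness `d.N = 0`, not demanded). Semi-global Minkowski stability from a late
  hyperboloidal leaf (Friedrich 1986; Christodoulou–Klainerman 1993 / Lindblad–Rodnianski for the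
  decay on flat slabs) PLUS the far exterior near `i⁰`, which no leaf sees and where only the
  admissible `o₂(r⁻¹)` tail is available (Klainerman–Nicolò-type exterior stability, which as published
  needs weighted decay beyond that tail): the flat slabs `{x⁰ = τ}` of `d` reach `i⁰`. Size L–XL.
* `stub_pinnedKerrCapture` — PINNED (MULTI-)KERR CAPTURE (sector `0 < N`): the same with `N ≥ 1`
  pinned sub-extremal labels ⇒ the same four exterior clauses. `N = 1`: sub-extremal Kerr stability
  in leaf form with known limiting parameters (Dafermos–Rodnianski Conj. 5.1; proved only for
  `|a| ≪ M`, Klainerman–Szeftel 2023, Giorgi–Klainerman–Szeftel 2022; linear theory for `|a| < M`,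
  Shlapentokh-Rothman–Teixeira da Costa 2020/23); `N ≥ 2`: capture of `N` holes which at fine leaves
  are `≳ M/ε` apart (the other holes' monopole fields must be `≤ ε` on each certified slab) and, being
  pinned for all `(k, ε, K)`, never merge again — no theorem. Open
  problem; size XL. This is the load-bearing stub.
* `stub_raysEventuallyVisible` — NO HIDING PLACE FOR COMPLETE RAYS (interior content of T2,
  chart-relative): under the crux's hypotheses, for EVERY settled exterior `(O, d)` with the four
  clauses, every future-complete normalised null ray from `Σ` is, beyond every affine parameter,
  again in `closure d.charted` (honest exhaustive charts reach the event horizons and cover the late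
  far region, so escaping rays, photon-sphere orbiters and horizon generators are frequently
  charted; no future-complete null ray from `Σ` stays inside a black hole: exact sub-extremal Kerr —
  every interior null geodesic reaches `r = r₋` resp. `r = 0` at finite affine parameter; near Kerr —
  Dafermos–Luk 2017; dynamical `N ≥ 2` interiors unknown). Size L–XL.
* `stub_visibleRaysStay` — VISIBLE POINTS OF RAYS LIE IN `closure O` (causal theory, no dynamics;
  statement byte-identical to the sibling's): for `O = exteriorOf 𝒟 d.charted = J⁺(ιΣ) ∩ I⁻(d.charted)`,
  a point `γ t`, `t ≥ 0`, of a normalised null ray from `Σ` which at some later parameter `t' ≥ t`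
  lies in `closure d.charted` is in `closure O` (the ray segment is a future causal curve; open
  `U ⊆ I⁻(U)`; push-up `J⁻(closure I⁻U) ⊆ closure I⁻U`; `J⁺(Σ) ∖ Σ = I⁺(Σ)` open for the spacelike
  Cauchy hypersurface `ιΣ`; `t = 0` by closedness). Size M; provable now over the prelude's causal
  theory.

The four statements are recorded as named propositions `PinnedDispersal`, `PinnedKerrCapture`,
`RaysEventuallyVisible`, `VisibleRaysStay` with `Goal.stub_*` abbreviations (the skeleton audit reads
the hypotheses of `PinnedCapture_of` BY STUB NAME). `PinnedCapture_of` assembles them: split the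
pinned hole count `N` into `N = 0` / `0 < N` for the exterior clauses; for a complete ray and
`t ≥ 0`, `stub_raysEventuallyVisible` gives a later charted parameter and `stub_visibleRaysStay` puts
`γ t` in `closure O` — that is `RaysStayInClosure 𝒟 O`. Sorries live only in the four stubs.
Disproof used: none exists for this crux (`ledger crux ls stmt-FinalStateConjecture-17315`: no
workfiles, 2026-08-17); no landed `Theorems/PinnedCapture/Negative/*`.
-/

set_option linter.dupNamespace false

namespace Summit.FinalStateConjecture.FinalStateConjecture.Cruxes.PinnedCapture.Birth

open scoped BigOperators Topology Manifold Classical MeasureTheory ProbabilityTheory Matrix InnerProductSpace ComplexConjugate ContinuousMap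
open Filter Set Function TopologicalSpace MeasureTheory
open Literature.Geometry.Lorentzian

/-! ## Statements of the four stubs as named propositions (the skeleton audit reads the hypotheses of
`PinnedCapture_of` BY NAME: each head must be a declared stub, whence the `Goal.stub_*` abbreviations). -/

/-- Statement of `stub_pinnedDispersal` (PINNED DISPERSAL, sector `N = 0`). -/
def PinnedDispersal : Prop := ∀ (X : Type) [TopologicalSpace X] [ChartedSpace E3 X] [IsManifold (𝓡 3) ((⊤ : ℕ∞) : WithTop ℕ∞) X] [T2Space X] [SecondCountableTopology X] [ConnectedSpace X], ∀ D ∈ admissibleVacuumData X, ∀ 𝒟 : VacuumCauchyDevelopment D, 𝒟.IsMaximal → Summit.FinalStateConjecture.HasCompleteNullInfinity 𝒟.toCauchyDevelopment → ∀ (N : ℕ) (M a : Fin N → ℝ), N = 0 → (∀ i, Kerr.IsSubextremal (M i) (a i)) → (∀ (k : ℕ) (ε : ENNReal), 0 < ε → ∀ K : Set 𝒟.carrier, IsCompact K → ∃ S : Set 𝒟.carrier, Disjoint S (𝒟.metric.causalPast 𝒟.timeOrientation K) ∧ (∃ (R ρ : Fin N → ℝ) (mo : Fin N → lorentzGroup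 × E4) (r : Fin N → E4 → ℝ) (B : Fin N → ModelBackground) (U₀ : TopologicalSpace.Opens E4) (B₀ : ModelBackground) (Ψ : ∀ i, (B i).domain → 𝒟.carrier) (Ψ₀ : B₀.domain → 𝒟.carrier) (L W : ∀ i, Set (B i).domain) (L₀ W₀ : Set B₀.domain), (∀ i, r i = fun x => Kerr.radius (a i) (poincareInv (mo i).1 (mo i).2 x)) ∧ (∀ i, B i = (⟨⟨poincareInv (mo i).1 (mo i).2 ⁻¹' (Kerr.region (a i) (M i) : Set E4), (Kerr.region (a i) (M i)).isOpen.preimage (continuous_poincareInv (mo i).1 (mo i).2)⟩, boostedKerrBilin (mo i).1 (mo i).2 (M i) (a i), fun x => poincareInv (mo i).1 (mo i).2 x 0, r i⟩ : ModelBackground)) ∧ B₀ = (⟨U₀, fun _ => Minkowski.bilin, fun x => x 0 - Real.sqrt (1 + E4.spatialNorm x ^ 2), E4.spatialNorm⟩ : ModelBackground) ∧ (∀ i, L i = {x | -1 < (B i).time x.1 ∧ (B i).time x.1 < 1 ∧ (B i).radius x.1 < R i + 1} ∧ W i = {x | 0 < (B i).time x.1 ∧ (B i).time x.1 < 1 ∧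 (B i).radius x.1 ≤ R i}) ∧ L₀ = {x | -1 < B₀.time x.1 ∧ B₀.time x.1 < 1} ∧ W₀ = {x | 0 < B₀.time x.1 ∧ B₀.time x.1 < 1} ∧ (∀ i, 0 < M i ∧ |a i| ≤ M i ∧ 0 < ρ i ∧ ρ i < R i ∧ 2 * M i ≤ R i) ∧ {x : E4 | -1 < x 0 - Real.sqrt (1 + E4.spatialNorm x ^ 2) ∧ ∀ i, ρ i < r i x} ⊆ (U₀ : Set E4) ∧ (∀ i, ContMDiffOn 𝓘(ℝ, E4) (𝓡 4) ((⊤ : ℕ∞) : WithTop ℕ∞) (Ψ i) (L i) ∧ Topology.IsOpenEmbedding ((L i).restrict (Ψ i)) ∧ Ψ i '' L i ⊆ 𝒟.metric.causalFuture 𝒟.timeOrientation (Set.range 𝒟.embed)) ∧ ContMDiffOn 𝓘(ℝ, E4) (𝓡 4) ((⊤ : ℕ∞) : WithTop ℕ∞) Ψ₀ L₀ ∧ Topology.IsOpenEmbedding (L₀.restrict Ψ₀) ∧ Ψ₀ '' L₀ ⊆ 𝒟.metric.causalFuture 𝒟.timeOrientation (Set.range 𝒟.embed) ∧ (∀ i,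 𝒟.toSpacetime.truncDeviationCk (B i) (Ψ i) k (R i) 0 ≤ ε) ∧ 𝒟.toSpacetime.deviationCk B₀ Ψ₀ k 0 ≤ ε ∧ Pairwise (Function.onFun Disjoint fun i => Ψ i '' {x | x ∈ L i ∧ (B i).radius x.1 ≤ R i}) ∧ (∀ i, Ψ i '' {x | (B i).time x.1 = 0 ∧ ρ i < (B i).radius x.1 ∧ (B i).radius x.1 ≤ R i} ⊆ Ψ₀ '' L₀) ∧ (∀ i, Ψ₀ '' {x | B₀.time x.1 = 0 ∧ ρ i < r i x.1 ∧ r i x.1 < R i} ⊆ Ψ i '' L i) ∧ S = Ψ₀ '' B₀.timeSlab 0 ∪ ⋃ i, Ψ i '' (B i).truncTimeSlab (R i) 0 ∧ Ψ₀ '' W₀ ∪ ⋃ i, Ψ i '' W i ⊆ 𝒟.metric.chronologicalFuture 𝒟.timeOrientation S ∧ Summit.FinalStateConjecture.exteriorOf 𝒟.toCauchyDevelopment (Ψ₀ '' W₀ ∪ ⋃ i, Ψ i '' W i) \ (Ψ₀ '' W₀ ∪ ⋃ i, Ψ i '' W i) ⊆ 𝒟.metric.causalPast 𝒟.timeOrientation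 S)) → ∃ (O : Set 𝒟.carrier) (d : FinalStateDecomposition 𝒟.toSpacetime O 2), (∀ i, Kerr.IsSubextremal (d.mass i) (d.spin i)) ∧ O = Summit.FinalStateConjecture.exteriorOf 𝒟.toCauchyDevelopment d.charted ∧ Summit.FinalStateConjecture.HasExhaustiveCharts d ∧ Summit.FinalStateConjecture.IsFutureOriented d

/-- Statement of `stub_pinnedKerrCapture` (PINNED (MULTI-)KERR CAPTURE, sector `0 < N`). -/
def PinnedKerrCapture : Prop := ∀ (X : Type) [TopologicalSpace X] [ChartedSpace E3 X] [IsManifold (𝓡 3) ((⊤ : ℕ∞) : WithTop ℕ∞) X] [T2Space X] [SecondCountableTopology X] [ConnectedSpace X], ∀ D ∈ admissibleVacuumData X, ∀ 𝒟 : VacuumCauchyDevelopment D, 𝒟.IsMaximal → Summit.FinalStateConjecture.HasCompleteNullInfinity 𝒟.toCauchyDevelopment → ∀ (N : ℕ) (M a : Fin N → ℝ), 0 < N → (∀ i, Kerr.IsSubextremal (M i) (a i)) → (∀ (k : ℕ) (ε : ENNReal), 0 < ε → ∀ K : Set 𝒟.carrier, IsCompact K → ∃ S : Set 𝒟.carrier,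 Disjoint S (𝒟.metric.causalPast 𝒟.timeOrientation K) ∧ (∃ (R ρ : Fin N → ℝ) (mo : Fin N → lorentzGroup × E4) (r : Fin N → E4 → ℝ) (B : Fin N → ModelBackground) (U₀ : TopologicalSpace.Opens E4) (B₀ : ModelBackground) (Ψ : ∀ i, (B i).domain → 𝒟.carrier) (Ψ₀ : B₀.domain → 𝒟.carrier) (L W : ∀ i, Set (B i).domain) (L₀ W₀ : Set B₀.domain), (∀ i, r i = fun x => Kerr.radius (a i) (poincareInv (mo i).1 (mo i).2 x)) ∧ (∀ i, B i = (⟨⟨poincareInv (mo i).1 (mo i).2 ⁻¹' (Kerr.region (a i) (M i) : Set E4), (Kerr.region (a i) (M i)).isOpen.preimage (continuous_poincareInv (mo i).1 (mo i).2)⟩, boostedKerrBilin (mo i).1 (mo i).2 (M i) (a i), fun x => poincareInv (mo i).1 (mo i).2 x 0, r i⟩ : ModelBackground)) ∧ B₀ = (⟨U₀, fun _ => Minkowski.bilin, fun x => x 0 - Real.sqrt (1 + E4.spatialNorm x ^ 2), E4.spatialNorm⟩ : ModelBackground) ∧ (∀ i, L i = {x | -1 < (B i).time x.1 ∧ (B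 i).time x.1 < 1 ∧ (B i).radius x.1 < R i + 1} ∧ W i = {x | 0 < (B i).time x.1 ∧ (B i).time x.1 < 1 ∧ (B i).radius x.1 ≤ R i}) ∧ L₀ = {x | -1 < B₀.time x.1 ∧ B₀.time x.1 < 1} ∧ W₀ = {x | 0 < B₀.time x.1 ∧ B₀.time x.1 < 1} ∧ (∀ i, 0 < M i ∧ |a i| ≤ M i ∧ 0 < ρ i ∧ ρ i < R i ∧ 2 * M i ≤ R i) ∧ {x : E4 | -1 < x 0 - Real.sqrt (1 + E4.spatialNorm x ^ 2) ∧ ∀ i, ρ i < r i x} ⊆ (U₀ : Set E4) ∧ (∀ i, ContMDiffOn 𝓘(ℝ, E4) (𝓡 4) ((⊤ : ℕ∞) : WithTop ℕ∞) (Ψ i) (L i) ∧ Topology.IsOpenEmbedding ((L i).restrict (Ψ i)) ∧ Ψ i '' L i ⊆ 𝒟.metric.causalFuture 𝒟.timeOrientation (Set.range 𝒟.embed)) ∧ ContMDiffOn 𝓘(ℝ, E4) (𝓡 4) ((⊤ : ℕ∞) : WithTop ℕ∞) Ψ₀ L₀ ∧ Topology.IsOpenEmbedding (L₀.restrict Ψ₀)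 ∧ Ψ₀ '' L₀ ⊆ 𝒟.metric.causalFuture 𝒟.timeOrientation (Set.range 𝒟.embed) ∧ (∀ i, 𝒟.toSpacetime.truncDeviationCk (B i) (Ψ i) k (R i) 0 ≤ ε) ∧ 𝒟.toSpacetime.deviationCk B₀ Ψ₀ k 0 ≤ ε ∧ Pairwise (Function.onFun Disjoint fun i => Ψ i '' {x | x ∈ L i ∧ (B i).radius x.1 ≤ R i}) ∧ (∀ i, Ψ i '' {x | (B i).time x.1 = 0 ∧ ρ i < (B i).radius x.1 ∧ (B i).radius x.1 ≤ R i} ⊆ Ψ₀ '' L₀) ∧ (∀ i, Ψ₀ '' {x | B₀.time x.1 = 0 ∧ ρ i < r i x.1 ∧ r i x.1 < R i} ⊆ Ψ i '' L i) ∧ S = Ψ₀ '' B₀.timeSlab 0 ∪ ⋃ i, Ψ i '' (B i).truncTimeSlab (R i) 0 ∧ Ψ₀ '' W₀ ∪ ⋃ i, Ψ i '' W i ⊆ 𝒟.metric.chronologicalFuture 𝒟.timeOrientation S ∧ Summit.FinalStateConjecture.exteriorOf 𝒟.toCauchyDevelopment (Ψ₀ '' W₀ ∪ ⋃ i, Ψ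 i '' W i) \ (Ψ₀ '' W₀ ∪ ⋃ i, Ψ i '' W i) ⊆ 𝒟.metric.causalPast 𝒟.timeOrientation S)) → ∃ (O : Set 𝒟.carrier) (d : FinalStateDecomposition 𝒟.toSpacetime O 2), (∀ i, Kerr.IsSubextremal (d.mass i) (d.spin i)) ∧ O = Summit.FinalStateConjecture.exteriorOf 𝒟.toCauchyDevelopment d.charted ∧ Summit.FinalStateConjecture.HasExhaustiveCharts d ∧ Summit.FinalStateConjecture.IsFutureOriented d

/-- Statement of `stub_raysEventuallyVisible` (NO HIDING PLACE FOR COMPLETE RAYS). -/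
def RaysEventuallyVisible : Prop := ∀ (X : Type) [TopologicalSpace X] [ChartedSpace E3 X] [IsManifold (𝓡 3) ((⊤ : ℕ∞) : WithTop ℕ∞) X] [T2Space X] [SecondCountableTopology X] [ConnectedSpace X], ∀ D ∈ admissibleVacuumData X, ∀ 𝒟 : VacuumCauchyDevelopment D, 𝒟.IsMaximal → Summit.FinalStateConjecture.HasCompleteNullInfinity 𝒟.toCauchyDevelopment → (∃ (N : ℕ) (M a : Fin N → ℝ), (∀ i, Kerr.IsSubextremal (M i) (a i)) ∧ ∀ (k : ℕ) (ε : ENNReal), 0 < ε → ∀ K : Set 𝒟.carrier, IsCompact K → ∃ S : Set 𝒟.carrier, Disjoint S (𝒟.metric.causalPast 𝒟.timeOrientation K) ∧ (∃ (R ρ : Fin N → ℝ) (mo : Fin N → lorentzGroup × E4) (r : Fin N → E4 → ℝ) (B : Fin N → ModelBackground) (U₀ : TopologicalSpace.Opens E4) (B₀ : ModelBackground) (Ψ : ∀ i, (B i).domain → 𝒟.carrier) (Ψ₀ : B₀.domain → 𝒟.carrier) (L W : ∀ i, Set (B i).domain) (L₀ W₀ : Set B₀.domain), (∀ i, r i =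 fun x => Kerr.radius (a i) (poincareInv (mo i).1 (mo i).2 x)) ∧ (∀ i, B i = (⟨⟨poincareInv (mo i).1 (mo i).2 ⁻¹' (Kerr.region (a i) (M i) : Set E4), (Kerr.region (a i) (M i)).isOpen.preimage (continuous_poincareInv (mo i).1 (mo i).2)⟩, boostedKerrBilin (mo i).1 (mo i).2 (M i) (a i), fun x => poincareInv (mo i).1 (mo i).2 x 0, r i⟩ : ModelBackground)) ∧ B₀ = (⟨U₀, fun _ => Minkowski.bilin, fun x => x 0 - Real.sqrt (1 + E4.spatialNorm x ^ 2), E4.spatialNorm⟩ : ModelBackground) ∧ (∀ i, L i = {x | -1 < (B i).time x.1 ∧ (B i).time x.1 < 1 ∧ (B i).radius x.1 < R i + 1} ∧ W i = {x | 0 < (B i).time x.1 ∧ (B i).time x.1 < 1 ∧ (B i).radius x.1 ≤ R i}) ∧ L₀ = {x | -1 < B₀.time x.1 ∧ B₀.time x.1 < 1} ∧ W₀ = {x | 0 < B₀.time x.1 ∧ B₀.time x.1 < 1} ∧ (∀ i, 0 < M i ∧ |a i| ≤ M i ∧ 0 < ρ i ∧ ρ i < R i ∧ 2 * M i ≤ R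 i) ∧ {x : E4 | -1 < x 0 - Real.sqrt (1 + E4.spatialNorm x ^ 2) ∧ ∀ i, ρ i < r i x} ⊆ (U₀ : Set E4) ∧ (∀ i, ContMDiffOn 𝓘(ℝ, E4) (𝓡 4) ((⊤ : ℕ∞) : WithTop ℕ∞) (Ψ i) (L i) ∧ Topology.IsOpenEmbedding ((L i).restrict (Ψ i)) ∧ Ψ i '' L i ⊆ 𝒟.metric.causalFuture 𝒟.timeOrientation (Set.range 𝒟.embed)) ∧ ContMDiffOn 𝓘(ℝ, E4) (𝓡 4) ((⊤ : ℕ∞) : WithTop ℕ∞) Ψ₀ L₀ ∧ Topology.IsOpenEmbedding (L₀.restrict Ψ₀) ∧ Ψ₀ '' L₀ ⊆ 𝒟.metric.causalFuture 𝒟.timeOrientation (Set.range 𝒟.embed) ∧ (∀ i, 𝒟.toSpacetime.truncDeviationCk (B i) (Ψ i) k (R i) 0 ≤ ε) ∧ 𝒟.toSpacetime.deviationCk B₀ Ψ₀ k 0 ≤ ε ∧ Pairwise (Function.onFun Disjoint fun i => Ψ i '' {x | x ∈ L i ∧ (B i).radius x.1 ≤ R i}) ∧ (∀ i, Ψ i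 '' {x | (B i).time x.1 = 0 ∧ ρ i < (B i).radius x.1 ∧ (B i).radius x.1 ≤ R i} ⊆ Ψ₀ '' L₀) ∧ (∀ i, Ψ₀ '' {x | B₀.time x.1 = 0 ∧ ρ i < r i x.1 ∧ r i x.1 < R i} ⊆ Ψ i '' L i) ∧ S = Ψ₀ '' B₀.timeSlab 0 ∪ ⋃ i, Ψ i '' (B i).truncTimeSlab (R i) 0 ∧ Ψ₀ '' W₀ ∪ ⋃ i, Ψ i '' W i ⊆ 𝒟.metric.chronologicalFuture 𝒟.timeOrientation S ∧ Summit.FinalStateConjecture.exteriorOf 𝒟.toCauchyDevelopment (Ψ₀ '' W₀ ∪ ⋃ i, Ψ i '' W i) \ (Ψ₀ '' W₀ ∪ ⋃ i, Ψ i '' W i) ⊆ 𝒟.metric.causalPast 𝒟.timeOrientation S)) → ∀ (O : Set 𝒟.carrier) (d : FinalStateDecomposition 𝒟.toSpacetime O 2), (∀ i, Kerr.IsSubextremal (d.mass i) (d.spin i)) → O = Summit.FinalStateConjecture.exteriorOf 𝒟.toCauchyDevelopment d.charted → Summit.FinalStateConjecture.HasExhaustiveCharts d → Summit.FinalStateConjecture.IsFutureOriented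 d → ∀ [𝒟.metric.HasLeviCivita], ∀ (p : X) (γ : ℝ → 𝒟.carrier) (dom : Set ℝ), 𝒟.metric.IsNormalisedNullRayFrom 𝒟.timeOrientation 𝒟.embed 𝒟.normal p γ dom → ¬ BddAbove dom → ∀ t ∈ dom, ∃ t' ∈ dom, t ≤ t' ∧ γ t' ∈ closure d.charted

/-- Statement of `stub_visibleRaysStay` (VISIBLE POINTS OF RAYS LIE IN `closure O`; byte-identical to the
sibling skeleton `Cruxes/SettledCapture/Lines/birth.lean`). -/
def VisibleRaysStay : Prop := ∀ (X : Type) [TopologicalSpace X] [ChartedSpace E3 X] [IsManifold (𝓡 3) ((⊤ : ℕ∞) : WithTop ℕ∞) X] [T2Space X] [SecondCountableTopology X] [ConnectedSpace X], ∀ D ∈ admissibleVacuumData X, ∀ 𝒟 : VacuumCauchyDevelopment D, ∀ (O : Set 𝒟.carrier) (d : FinalStateDecomposition 𝒟.toSpacetime O 2), O = Summit.FinalStateConjecture.exteriorOf 𝒟.toCauchyDevelopment d.charted → ∀ [𝒟.metric.HasLeviCivita], ∀ (p : X) (γ : ℝ → 𝒟.carrier) (dom : Set ℝ), 𝒟.metric.IsNormalisedNullRayFrom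 𝒟.timeOrientation 𝒟.embed 𝒟.normal p γ dom → ∀ t ∈ dom, ∀ t' ∈ dom, 0 ≤ t → t ≤ t' → γ t' ∈ closure d.charted → γ t ∈ closure O

namespace Goal
/-- Statement of `stub_pinnedDispersal`, under the stub's name. -/
abbrev stub_pinnedDispersal : Prop := PinnedDispersal
/-- Statement of `stub_pinnedKerrCapture`, under the stub's name. -/
abbrev stub_pinnedKerrCapture : Prop := PinnedKerrCapture
/-- Statement of `stub_raysEventuallyVisible`, under the stub's name. -/
abbrev stub_raysEventuallyVisible : Prop := RaysEventuallyVisible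
/-- Statement of `stub_visibleRaysStay`, under the stub's name. -/
abbrev stub_visibleRaysStay : Prop := VisibleRaysStay
end Goal

/-! ## Registered stubs (the only `sorry`s of the file), stated expanded. -/

/-- stub 1 — PINNED DISPERSAL (sector `N = 0`): maximal, complete `𝓘⁺`, recurrent `(ε,k)`-flat
hyperboloidal leaves beyond every `J⁻(K)` ⇒ a C² final-state decomposition of `O = exteriorOf 𝒟 d.charted`
with sub-extremal holes, exhaustive honest-radius charts and future-oriented chart times (everything but
the ray clause). -/
theorem stub_pinnedDispersal : ∀ (X : Type) [TopologicalSpace X] [ChartedSpace E3 X] [IsManifold (𝓡 3) ((⊤ : ℕ∞) : WithTop ℕ∞) X] [T2Space X] [SecondCountableTopology X] [ConnectedSpace X], ∀ D ∈ admissibleVacuumData X, ∀ 𝒟 : VacuumCauchyDevelopment D, 𝒟.IsMaximal → Summit.FinalStateConjecture.HasCompleteNullInfinity 𝒟.toCauchyDevelopment → ∀ (N : ℕ) (M a : Fin N → ℝ), N = 0 → (∀ i, Kerr.IsSubextremal (M i) (a i)) → (∀ (k : ℕ) (ε : ENNReal), 0 < ε → ∀ K : Set 𝒟.carrier, IsCompact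 K → ∃ S : Set 𝒟.carrier, Disjoint S (𝒟.metric.causalPast 𝒟.timeOrientation K) ∧ (∃ (R ρ : Fin N → ℝ) (mo : Fin N → lorentzGroup × E4) (r : Fin N → E4 → ℝ) (B : Fin N → ModelBackground) (U₀ : TopologicalSpace.Opens E4) (B₀ : ModelBackground) (Ψ : ∀ i, (B i).domain → 𝒟.carrier) (Ψ₀ : B₀.domain → 𝒟.carrier) (L W : ∀ i, Set (B i).domain) (L₀ W₀ : Set B₀.domain), (∀ i, r i = fun x => Kerr.radius (a i) (poincareInv (mo i).1 (mo i).2 x)) ∧ (∀ i, B i = (⟨⟨poincareInv (mo i).1 (mo i).2 ⁻¹' (Kerr.region (a i) (M i) : Set E4), (Kerr.region (a i) (M i)).isOpen.preimage (continuous_poincareInv (mo i).1 (mo i).2)⟩, boostedKerrBilin (mo i).1 (mo i).2 (M i) (a i), fun x => poincareInv (mo i).1 (mo i).2 x 0, r i⟩ : ModelBackground)) ∧ B₀ = (⟨U₀, fun _ => Minkowski.bilin, fun x => x 0 - Real.sqrt (1 + E4.spatialNorm x ^ 2), E4.spatialNorm⟩ : ModelBackground) ∧ (∀ i, L i = {x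 | -1 < (B i).time x.1 ∧ (B i).time x.1 < 1 ∧ (B i).radius x.1 < R i + 1} ∧ W i = {x | 0 < (B i).time x.1 ∧ (B i).time x.1 < 1 ∧ (B i).radius x.1 ≤ R i}) ∧ L₀ = {x | -1 < B₀.time x.1 ∧ B₀.time x.1 < 1} ∧ W₀ = {x | 0 < B₀.time x.1 ∧ B₀.time x.1 < 1} ∧ (∀ i, 0 < M i ∧ |a i| ≤ M i ∧ 0 < ρ i ∧ ρ i < R i ∧ 2 * M i ≤ R i) ∧ {x : E4 | -1 < x 0 - Real.sqrt (1 + E4.spatialNorm x ^ 2) ∧ ∀ i, ρ i < r i x} ⊆ (U₀ : Set E4) ∧ (∀ i, ContMDiffOn 𝓘(ℝ, E4) (𝓡 4) ((⊤ : ℕ∞) : WithTop ℕ∞) (Ψ i) (L i) ∧ Topology.IsOpenEmbedding ((L i).restrict (Ψ i)) ∧ Ψ i '' L i ⊆ 𝒟.metric.causalFuture 𝒟.timeOrientation (Set.range 𝒟.embed)) ∧ ContMDiffOn 𝓘(ℝ, E4) (𝓡 4) ((⊤ : ℕ∞) : WithTop ℕ∞) Ψ₀ L₀ ∧ Topology.IsOpenEmbedding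 (L₀.restrict Ψ₀) ∧ Ψ₀ '' L₀ ⊆ 𝒟.metric.causalFuture 𝒟.timeOrientation (Set.range 𝒟.embed) ∧ (∀ i, 𝒟.toSpacetime.truncDeviationCk (B i) (Ψ i) k (R i) 0 ≤ ε) ∧ 𝒟.toSpacetime.deviationCk B₀ Ψ₀ k 0 ≤ ε ∧ Pairwise (Function.onFun Disjoint fun i => Ψ i '' {x | x ∈ L i ∧ (B i).radius x.1 ≤ R i}) ∧ (∀ i, Ψ i '' {x | (B i).time x.1 = 0 ∧ ρ i < (B i).radius x.1 ∧ (B i).radius x.1 ≤ R i} ⊆ Ψ₀ '' L₀) ∧ (∀ i, Ψ₀ '' {x | B₀.time x.1 = 0 ∧ ρ i < r i x.1 ∧ r i x.1 < R i} ⊆ Ψ i '' L i) ∧ S = Ψ₀ '' B₀.timeSlab 0 ∪ ⋃ i, Ψ i '' (B i).truncTimeSlab (R i) 0 ∧ Ψ₀ '' W₀ ∪ ⋃ i, Ψ i '' W i ⊆ 𝒟.metric.chronologicalFuture 𝒟.timeOrientation S ∧ Summit.FinalStateConjecture.exteriorOf 𝒟.toCauchyDevelopment (Ψ₀ '' W₀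 ∪ ⋃ i, Ψ i '' W i) \ (Ψ₀ '' W₀ ∪ ⋃ i, Ψ i '' W i) ⊆ 𝒟.metric.causalPast 𝒟.timeOrientation S)) → ∃ (O : Set 𝒟.carrier) (d : FinalStateDecomposition 𝒟.toSpacetime O 2), (∀ i, Kerr.IsSubextremal (d.mass i) (d.spin i)) ∧ O = Summit.FinalStateConjecture.exteriorOf 𝒟.toCauchyDevelopment d.charted ∧ Summit.FinalStateConjecture.HasExhaustiveCharts d ∧ Summit.FinalStateConjecture.IsFutureOriented d := by
  sorry

/-- stub 2 — PINNED (MULTI-)KERR CAPTURE (sector `0 < N`): maximal, complete `𝓘⁺`, recurrent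
`(ε,k)`-near-Kerr leaves pinned to ONE sub-extremal configuration `(N; M, a)`, `N ≥ 1`, beyond every
`J⁻(K)` ⇒ the same four exterior clauses (the load-bearing stub: sub-extremal Kerr stability with known
limiting parameters for `N = 1`, multi-Kerr capture for `N ≥ 2`). -/
theorem stub_pinnedKerrCapture : ∀ (X : Type) [TopologicalSpace X] [ChartedSpace E3 X] [IsManifold (𝓡 3) ((⊤ : ℕ∞) : WithTop ℕ∞) X] [T2Space X] [SecondCountableTopology X] [ConnectedSpace X], ∀ D ∈ admissibleVacuumData X, ∀ 𝒟 : VacuumCauchyDevelopment D, 𝒟.IsMaximal → Summit.FinalStateConjecture.HasCompleteNullInfinity 𝒟.toCauchyDevelopment → ∀ (N : ℕ) (M a : Fin N → ℝ), 0 < N → (∀ i, Kerr.IsSubextremal (M i) (a i)) → (∀ (k : ℕ) (ε : ENNReal), 0 < ε → ∀ K : Set 𝒟.carrier, IsCompact K → ∃ S : Set 𝒟.carrier, Disjoint S (𝒟.metric.causalPast 𝒟.timeOrientation K) ∧ (∃ (R ρ : Fin N → ℝ) (mo : Fin N → lorentzGroup × E4) (r : Fin N → E4 → ℝ) (B : Fin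 N → ModelBackground) (U₀ : TopologicalSpace.Opens E4) (B₀ : ModelBackground) (Ψ : ∀ i, (B i).domain → 𝒟.carrier) (Ψ₀ : B₀.domain → 𝒟.carrier) (L W : ∀ i, Set (B i).domain) (L₀ W₀ : Set B₀.domain), (∀ i, r i = fun x => Kerr.radius (a i) (poincareInv (mo i).1 (mo i).2 x)) ∧ (∀ i, B i = (⟨⟨poincareInv (mo i).1 (mo i).2 ⁻¹' (Kerr.region (a i) (M i) : Set E4), (Kerr.region (a i) (M i)).isOpen.preimage (continuous_poincareInv (mo i).1 (mo i).2)⟩, boostedKerrBilin (mo i).1 (mo i).2 (M i) (a i), fun x => poincareInv (mo i).1 (mo i).2 x 0, r i⟩ : ModelBackground)) ∧ B₀ = (⟨U₀, fun _ => Minkowski.bilin, fun x => x 0 - Real.sqrt (1 + E4.spatialNorm x ^ 2), E4.spatialNorm⟩ : ModelBackground) ∧ (∀ i, L i = {x | -1 < (B i).time x.1 ∧ (B i).time x.1 < 1 ∧ (B i).radius x.1 < R i + 1} ∧ W i = {x | 0 < (B i).time x.1 ∧ (B i).time x.1 < 1 ∧ (B i).radius x.1 ≤ R i}) ∧ L₀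 = {x | -1 < B₀.time x.1 ∧ B₀.time x.1 < 1} ∧ W₀ = {x | 0 < B₀.time x.1 ∧ B₀.time x.1 < 1} ∧ (∀ i, 0 < M i ∧ |a i| ≤ M i ∧ 0 < ρ i ∧ ρ i < R i ∧ 2 * M i ≤ R i) ∧ {x : E4 | -1 < x 0 - Real.sqrt (1 + E4.spatialNorm x ^ 2) ∧ ∀ i, ρ i < r i x} ⊆ (U₀ : Set E4) ∧ (∀ i, ContMDiffOn 𝓘(ℝ, E4) (𝓡 4) ((⊤ : ℕ∞) : WithTop ℕ∞) (Ψ i) (L i) ∧ Topology.IsOpenEmbedding ((L i).restrict (Ψ i)) ∧ Ψ i '' L i ⊆ 𝒟.metric.causalFuture 𝒟.timeOrientation (Set.range 𝒟.embed)) ∧ ContMDiffOn 𝓘(ℝ, E4) (𝓡 4) ((⊤ : ℕ∞) : WithTop ℕ∞) Ψ₀ L₀ ∧ Topology.IsOpenEmbedding (L₀.restrict Ψ₀) ∧ Ψ₀ '' L₀ ⊆ 𝒟.metric.causalFuture 𝒟.timeOrientation (Set.range 𝒟.embed) ∧ (∀ i, 𝒟.toSpacetime.truncDeviationCk (B i)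 (Ψ i) k (R i) 0 ≤ ε) ∧ 𝒟.toSpacetime.deviationCk B₀ Ψ₀ k 0 ≤ ε ∧ Pairwise (Function.onFun Disjoint fun i => Ψ i '' {x | x ∈ L i ∧ (B i).radius x.1 ≤ R i}) ∧ (∀ i, Ψ i '' {x | (B i).time x.1 = 0 ∧ ρ i < (B i).radius x.1 ∧ (B i).radius x.1 ≤ R i} ⊆ Ψ₀ '' L₀) ∧ (∀ i, Ψ₀ '' {x | B₀.time x.1 = 0 ∧ ρ i < r i x.1 ∧ r i x.1 < R i} ⊆ Ψ i '' L i) ∧ S = Ψ₀ '' B₀.timeSlab 0 ∪ ⋃ i, Ψ i '' (B i).truncTimeSlab (R i) 0 ∧ Ψ₀ '' W₀ ∪ ⋃ i, Ψ i '' W i ⊆ 𝒟.metric.chronologicalFuture 𝒟.timeOrientation S ∧ Summit.FinalStateConjecture.exteriorOf 𝒟.toCauchyDevelopment (Ψ₀ '' W₀ ∪ ⋃ i, Ψ i '' W i) \ (Ψ₀ '' W₀ ∪ ⋃ i, Ψ i '' W i) ⊆ 𝒟.metric.causalPast 𝒟.timeOrientation S)) → ∃ (O : Set 𝒟.carrier)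 (d : FinalStateDecomposition 𝒟.toSpacetime O 2), (∀ i, Kerr.IsSubextremal (d.mass i) (d.spin i)) ∧ O = Summit.FinalStateConjecture.exteriorOf 𝒟.toCauchyDevelopment d.charted ∧ Summit.FinalStateConjecture.HasExhaustiveCharts d ∧ Summit.FinalStateConjecture.IsFutureOriented d := by
  sorry

/-- stub 3 — NO HIDING PLACE FOR COMPLETE RAYS: under the crux's hypotheses, for every settled exterior
`(O, d)` of the development, every future-complete normalised null ray from `Σ` is, beyond every
parameter, again in `closure d.charted` (honest charts reach the horizons and cover the late far region;
no future-complete null ray from `Σ` stays inside a black hole). -/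
theorem stub_raysEventuallyVisible : ∀ (X : Type) [TopologicalSpace X] [ChartedSpace E3 X] [IsManifold (𝓡 3) ((⊤ : ℕ∞) : WithTop ℕ∞) X] [T2Space X] [SecondCountableTopology X] [ConnectedSpace X], ∀ D ∈ admissibleVacuumData X, ∀ 𝒟 : VacuumCauchyDevelopment D, 𝒟.IsMaximal → Summit.FinalStateConjecture.HasCompleteNullInfinity 𝒟.toCauchyDevelopment → (∃ (N : ℕ) (M a : Fin N → ℝ), (∀ i, Kerr.IsSubextremal (M i) (a i)) ∧ ∀ (k : ℕ) (ε : ENNReal), 0 < ε → ∀ K : Set 𝒟.carrier, IsCompact K → ∃ S : Set 𝒟.carrier, Disjoint S (𝒟.metric.causalPast 𝒟.timeOrientation K) ∧ (∃ (R ρ : Fin N → ℝ) (mo : Fin N → lorentzGroup × E4) (r : Fin N → E4 → ℝ) (B : Fin N → ModelBackground) (U₀ : TopologicalSpace.Opens E4) (B₀ : ModelBackground) (Ψ : ∀ i, (B i).domain → 𝒟.carrier) (Ψ₀ : B₀.domain → 𝒟.carrier) (L W : ∀ i, Set (B i).domain) (L₀ W₀ : Set B₀.domain), (∀ i, r i =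 fun x => Kerr.radius (a i) (poincareInv (mo i).1 (mo i).2 x)) ∧ (∀ i, B i = (⟨⟨poincareInv (mo i).1 (mo i).2 ⁻¹' (Kerr.region (a i) (M i) : Set E4), (Kerr.region (a i) (M i)).isOpen.preimage (continuous_poincareInv (mo i).1 (mo i).2)⟩, boostedKerrBilin (mo i).1 (mo i).2 (M i) (a i), fun x => poincareInv (mo i).1 (mo i).2 x 0, r i⟩ : ModelBackground)) ∧ B₀ = (⟨U₀, fun _ => Minkowski.bilin, fun x => x 0 - Real.sqrt (1 + E4.spatialNorm x ^ 2), E4.spatialNorm⟩ : ModelBackground) ∧ (∀ i, L i = {x | -1 < (B i).time x.1 ∧ (B i).time x.1 < 1 ∧ (B i).radius x.1 < R i + 1} ∧ W i = {x | 0 < (B i).time x.1 ∧ (B i).time x.1 < 1 ∧ (B i).radius x.1 ≤ R i}) ∧ L₀ = {x | -1 < B₀.time x.1 ∧ B₀.time x.1 < 1} ∧ W₀ = {x | 0 < B₀.time x.1 ∧ B₀.time x.1 < 1} ∧ (∀ i, 0 < M i ∧ |a i| ≤ M i ∧ 0 < ρ i ∧ ρ i < R i ∧ 2 * M i ≤ R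 i) ∧ {x : E4 | -1 < x 0 - Real.sqrt (1 + E4.spatialNorm x ^ 2) ∧ ∀ i, ρ i < r i x} ⊆ (U₀ : Set E4) ∧ (∀ i, ContMDiffOn 𝓘(ℝ, E4) (𝓡 4) ((⊤ : ℕ∞) : WithTop ℕ∞) (Ψ i) (L i) ∧ Topology.IsOpenEmbedding ((L i).restrict (Ψ i)) ∧ Ψ i '' L i ⊆ 𝒟.metric.causalFuture 𝒟.timeOrientation (Set.range 𝒟.embed)) ∧ ContMDiffOn 𝓘(ℝ, E4) (𝓡 4) ((⊤ : ℕ∞) : WithTop ℕ∞) Ψ₀ L₀ ∧ Topology.IsOpenEmbedding (L₀.restrict Ψ₀) ∧ Ψ₀ '' L₀ ⊆ 𝒟.metric.causalFuture 𝒟.timeOrientation (Set.range 𝒟.embed) ∧ (∀ i, 𝒟.toSpacetime.truncDeviationCk (B i) (Ψ i) k (R i) 0 ≤ ε) ∧ 𝒟.toSpacetime.deviationCk B₀ Ψ₀ k 0 ≤ ε ∧ Pairwise (Function.onFun Disjoint fun i => Ψ i '' {x | x ∈ L i ∧ (B i).radius x.1 ≤ R i}) ∧ (∀ i, Ψ i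 '' {x | (B i).time x.1 = 0 ∧ ρ i < (B i).radius x.1 ∧ (B i).radius x.1 ≤ R i} ⊆ Ψ₀ '' L₀) ∧ (∀ i, Ψ₀ '' {x | B₀.time x.1 = 0 ∧ ρ i < r i x.1 ∧ r i x.1 < R i} ⊆ Ψ i '' L i) ∧ S = Ψ₀ '' B₀.timeSlab 0 ∪ ⋃ i, Ψ i '' (B i).truncTimeSlab (R i) 0 ∧ Ψ₀ '' W₀ ∪ ⋃ i, Ψ i '' W i ⊆ 𝒟.metric.chronologicalFuture 𝒟.timeOrientation S ∧ Summit.FinalStateConjecture.exteriorOf 𝒟.toCauchyDevelopment (Ψ₀ '' W₀ ∪ ⋃ i, Ψ i '' W i) \ (Ψ₀ '' W₀ ∪ ⋃ i, Ψ i '' W i) ⊆ 𝒟.metric.causalPast 𝒟.timeOrientation S)) → ∀ (O : Set 𝒟.carrier) (d : FinalStateDecomposition 𝒟.toSpacetime O 2), (∀ i, Kerr.IsSubextremal (d.mass i) (d.spin i)) → O = Summit.FinalStateConjecture.exteriorOf 𝒟.toCauchyDevelopment d.charted → Summit.FinalStateConjecture.HasExhaustiveCharts d → Summit.FinalStateConjecture.IsFutureOriented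 d → ∀ [𝒟.metric.HasLeviCivita], ∀ (p : X) (γ : ℝ → 𝒟.carrier) (dom : Set ℝ), 𝒟.metric.IsNormalisedNullRayFrom 𝒟.timeOrientation 𝒟.embed 𝒟.normal p γ dom → ¬ BddAbove dom → ∀ t ∈ dom, ∃ t' ∈ dom, t ≤ t' ∧ γ t' ∈ closure d.charted := by
  sorry

/-- stub 4 — VISIBLE POINTS OF RAYS LIE IN `closure O` (causal theory): with
`O = exteriorOf 𝒟 d.charted`, a point `γ t` (`t ≥ 0`) of a normalised null ray from `Σ` that is in
`closure d.charted` at some later parameter `t' ≥ t` lies in `closure O`. Shared verbatim with the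
sibling crux `SettledCapture` (route `BartnikGapSettling`). -/
theorem stub_visibleRaysStay : ∀ (X : Type) [TopologicalSpace X] [ChartedSpace E3 X] [IsManifold (𝓡 3) ((⊤ : ℕ∞) : WithTop ℕ∞) X] [T2Space X] [SecondCountableTopology X] [ConnectedSpace X], ∀ D ∈ admissibleVacuumData X, ∀ 𝒟 : VacuumCauchyDevelopment D, ∀ (O : Set 𝒟.carrier) (d : FinalStateDecomposition 𝒟.toSpacetime O 2), O = Summit.FinalStateConjecture.exteriorOf 𝒟.toCauchyDevelopment d.charted → ∀ [𝒟.metric.HasLeviCivita], ∀ (p : X) (γ : ℝ → 𝒟.carrier) (dom : Set ℝ), 𝒟.metric.IsNormalisedNullRayFrom 𝒟.timeOrientation 𝒟.embed 𝒟.normal p γ dom → ∀ t ∈ dom, ∀ t' ∈ dom, 0 ≤ t → t ≤ t' → γ t' ∈ closure d.charted → γ t ∈ closure O := by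
  sorry

/-! Consistency (elaborated, not kept in the environment): each expanded stub statement is, by `δ`-unfolding,
the named proposition the composition consumes. -/
example : Goal.stub_pinnedDispersal := stub_pinnedDispersal
example : Goal.stub_pinnedKerrCapture := stub_pinnedKerrCapture
example : Goal.stub_raysEventuallyVisible := stub_raysEventuallyVisible
example : Goal.stub_visibleRaysStay := stub_visibleRaysStay

/-! ## The composition (kernel-checked; no `sorry` of its own) -/

/-- THE CRUX BY NAME from the four registered stubs: split the pinned hole count into the dispersal
sector `N = 0` (`stub_pinnedDispersal`) and the black-hole sector `0 < N` (`stub_pinnedKerrCapture`) to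
get the settled exterior `(O, d)`; for a complete ray and `t ≥ 0`, `stub_raysEventuallyVisible` gives a
later charted parameter and `stub_visibleRaysStay` puts `γ t` in `closure O` — that is
`RaysStayInClosure 𝒟 O`. -/
theorem PinnedCapture_of :
    Goal.stub_pinnedDispersal → Goal.stub_pinnedKerrCapture → Goal.stub_raysEventuallyVisible →
      Goal.stub_visibleRaysStay →
        Summit.FinalStateConjecture.FinalStateConjecture.Theses.MergerLatticeBudget.PinnedCapture := by
  intro h₀ h₁ h₂ h₃ X _ _ _ _ _ _ D hD 𝒟 hmax hscri hpin
  -- exterior capture, by sector of the pinned hole count (the sectors are independent: no phantoms)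
  have hext : ∃ (O : Set 𝒟.carrier) (d : FinalStateDecomposition 𝒟.toSpacetime O 2),
      (∀ i, Kerr.IsSubextremal (d.mass i) (d.spin i)) ∧
        O = Summit.FinalStateConjecture.exteriorOf 𝒟.toCauchyDevelopment d.charted ∧
          Summit.FinalStateConjecture.HasExhaustiveCharts d ∧
            Summit.FinalStateConjecture.IsFutureOriented d := by
    obtain ⟨N, M, a, hsub, hrec⟩ := hpin
    rcases Nat.eq_zero_or_pos N with hN | hN
    · exact h₀ X D hD 𝒟 hmax hscri N M a hN hsub hrec
    · exact h₁ X D hD 𝒟 hmax hscri N M a hN hsub hrec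
  obtain ⟨O, d, hsub, hO, hexh, hfut⟩ := hext
  refine ⟨O, d, hsub, hO, ?_, hexh, hfut⟩
  -- the T2 ray clause: complete rays are frequently charted, and charted-later points lie in closure O
  intro inst p γ dom hγ hdom t ht h0
  obtain ⟨t', ht', htt', hvis⟩ :=
    h₂ X D hD 𝒟 hmax hscri hpin O d hsub hO hexh hfut p γ dom hγ hdom t ht
  exact h₃ X D hD 𝒟 O d hO p γ dom hγ t ht t' ht' h0 htt' hvis

end Summit.FinalStateConjecture.FinalStateConjecture.Cruxes.PinnedCapture.Birth
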